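import Summits.Parity.BatemanHorn.Theorems.RoughValueTransportRoughValueLawStrength
import HarnessLib

/-!
# Crux `RoughValueLaw` (stmt-Parity-11390): the sharp Bateman–Horn UPPER bound in EVERY degree

Second half of the strength certificate of the crux `RoughValueLaw` of route `RoughValueTransport`
(first half: `Theorems/RoughValueTransportRoughValueLawStrength.lean` — the crux gives the full
Bateman–Horn asymptotic for every system of degree `≤ 2`, where the sibling crux
`BalancedSemiprimeLayer` is proved).  Here NO degree hypothesis is made: for every Bateman–Horn system
`f = (f₁, …, f_k)` of ANY degrees, the rung law for `f` alone (the body of `RoughValueLaw` at `f`: for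
every Buchstab function `ω` there is SOME constant `A` with `Φ_f(x,u)(log x)^k/x → A(uω(u))^k` for
every `u > 2`) already implies the SHARP upper bound

  `P_f(x) ≤ (C(f)/∏ deg fᵢ + ε) · x/(log x)^k`   for every `ε > 0` and all large `x`,

i.e. `limsup P_f(x)(log x)^k/x ≤ C(f)/∏ deg fᵢ` — the Bateman–Horn constant with factor `1`, where
the upper-bound sieve gives the factor `2^k · k!`-type losses of the parity barrier (for one polynomial
of degree `d`: `2d · C(f)/d`).  Proof: the upper half of the route's squeeze
(`batemanHornAsymptotic_of_parts`), which does not use the layer: instantiate at `ω = buchstabOmega`,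
pin `A = C(f)/∏deg` by the PROVED calibration `sieveCalibration_proof` and de Bruijn's
`ω(u) → e^{−γ}` (`harman2007_buchstabOmega_tendsto_holds`), bound `P_f(x) ≤ Φ_f(x,u) + K + k(2√x+1)`
(`polyPrimeCount_le_cruxCount_add`, all degrees) and let `u = 2/(1−δ) ↓ 2`, where
`(uω(u))^k = (1 + log(u−1))^k → 1` (`buchstabOmega_eq_of_mem_Icc_two_three`).

* `polyPrimeCount_eventually_le_of_parts` — per system, calibration as a hypothesis;
* `polyPrimeCount_eventually_le_of_systemRoughValueLaw` — per system, calibration discharged;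
* `stub_sharpUpperBound` / `sharpUpperBound_of_roughValueLaw` — `RoughValueLaw ⇒` the sharp upper
  bound for every Bateman–Horn system of every degree.

So even the one-sided content of the crux is parity-breaking for every system (e.g. `n³ + 2`,
`n⁴ + 1`), not only in degree `≤ 2` — the documented reason every line on this crux isolates an
open residual (`Cruxes/RoughValueLaw/Lines/*-dead.md`).

References: P. T. Bateman, R. A. Horn, Math. Comp. 16 (1962); G. Harman, *Prime-Detecting Sieves*
(2007), §1.4; A. Selberg, *Collected Papers* II (1991), Lectures on sieves §3 (parity).
-/

noncomputable section

open Filter Finset Polynomial Real Asymptotics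
open scoped Topology BigOperators
open Literature.NumberTheory.Sieve
open Summit.Parity.BatemanHorn.Theses.RoughValueTransport (RoughValueLaw)
open Summit.Parity.BatemanHorn.Theorems (sieveCalibration_proof)

namespace Summit.Parity.BatemanHorn.Cruxes.RoughValueLaw.Strength

/-- **Sharp upper bound from the rung law, ONE system of any degree, calibration as hypothesis.**
If for the Bateman–Horn system `f` (i) the rough-value shape holds for every Buchstab `ω` with SOME
constant `A` (the body of `RoughValueLaw` at `f`) and (ii) the constant is calibrated at infinite
depth (the body of `SieveCalibration` at `f`), then for every `ε > 0`, eventually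
`P_f(x) ≤ (C(f)/∏ deg fᵢ + ε)·x/(log x)^k`.  The upper half of `batemanHornAsymptotic_of_parts`;
no hypothesis on the degrees. [folklore] -/
theorem polyPrimeCount_eventually_le_of_parts {k : ℕ} {f : Fin k → ℤ[X]}
    (hf : IsBatemanHornSystem f)
    (hR : ∀ ω : ℝ → ℝ, ((∀ u : ℝ, 1 ≤ u → u ≤ 2 → ω u = u⁻¹) ∧ ContinuousOn ω (Set.Ici 1) ∧
        (∀ u : ℝ, 2 < u → HasDerivAt (fun t : ℝ => t * ω t) (ω (u - 1)) u)) →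
      ∃ A : ℝ, ∀ u : ℝ, 2 < u → Tendsto (fun x : ℕ =>
        (((Finset.Icc 1 x).filter (fun n : ℕ => ∀ i, 0 < (f i).eval (n : ℤ) ∧
          ∀ p ∈ Finset.range ⌈(x : ℝ) ^ (((f i).natDegree : ℝ) / u)⌉₊,
            p.Prime → ¬ ((p : ℤ) ∣ (f i).eval (n : ℤ)))).card : ℝ) * Real.log x ^ k / (x : ℝ))
        atTop (𝓝 (A * (u * ω u) ^ k)))
    (hS : ∀ L : ℝ → ℝ, (∃ u₀ : ℝ, ∀ u : ℝ, u₀ ≤ u → Tendsto (fun x : ℕ =>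
        (((Finset.Icc 1 x).filter (fun n : ℕ => ∀ i, 0 < (f i).eval (n : ℤ) ∧
          ∀ p ∈ Finset.range ⌈(x : ℝ) ^ (((f i).natDegree : ℝ) / u)⌉₊,
            p.Prime → ¬ ((p : ℤ) ∣ (f i).eval (n : ℤ)))).card : ℝ) * Real.log x ^ k / (x : ℝ))
        atTop (𝓝 (L u))) →
      Tendsto (fun u : ℝ => L u / u ^ k) atTop
        (𝓝 (batemanHornConst f / (∏ i, ((f i).natDegree : ℝ)) *
          Real.exp (-((k : ℝ) * Real.eulerMascheroniConstant))))) :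
    ∀ ε : ℝ, 0 < ε → ∀ᶠ x : ℕ in atTop, (polyPrimeCount f x : ℝ) ≤
      (batemanHornConst f / (∏ i, ((f i).natDegree : ℝ)) + ε) * x / Real.log x ^ k := by
  intro ε hε
  -- the constant `C₀ = C(f)/∏ deg fᵢ`
  obtain ⟨C₀, hC₀_def⟩ : ∃ C₀ : ℝ, C₀ = batemanHornConst f / ∏ i, ((f i).natDegree : ℝ) :=
    ⟨_, rfl⟩
  rw [← hC₀_def]
  -- Step 1: `ω = buchstabOmega` satisfies the inline predicate; `A` from the rough-value shape
  obtain ⟨A, hA⟩ := hR buchstabOmega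
    ⟨fun u h1 h2 => buchstabOmega_eq_inv h1 h2, continuousOn_buchstabOmega,
      fun u hu => hasDerivAt_mul_buchstabOmega hu⟩
  -- Step 2: calibration with `L u = A (u ω u)^k` and de Bruijn's limit pin `A = C₀`
  have hSC := hS (fun u => A * (u * buchstabOmega u) ^ k) ⟨3, fun u hu => hA u (by linarith)⟩
  rw [← hC₀_def] at hSC
  have hω := harman2007_buchstabOmega_tendsto_holds
  unfold harman2007_buchstabOmega_tendsto at hω
  have hSC' : Tendsto (fun u : ℝ => A * (u * buchstabOmega u) ^ k / u ^ k) atTop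
      (𝓝 (A * Real.exp (-Real.eulerMascheroniConstant) ^ k)) := by
    have h1 := (hω.pow k).const_mul A
    refine h1.congr' ?_
    filter_upwards [eventually_gt_atTop 0] with u hu
    rw [mul_pow]
    field_simp
  have hAeq : A = C₀ := by
    have huniq := tendsto_nhds_unique hSC' hSC
    have he : Real.exp (-((k : ℝ) * Real.eulerMascheroniConstant)) =
        Real.exp (-Real.eulerMascheroniConstant) ^ k := by
      rw [← Real.exp_nat_mul]
      congr 1
      ring
    rw [he] at huniq
    exact mul_right_cancel₀ (pow_ne_zero k (Real.exp_pos _).ne') huniq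
  -- Step 3: at `u = 2/(1−δ)` the count sifted to `x^{deg fᵢ(1−δ)/2}` is `Φ_f(x,u)`, with
  -- normalised limit `C₀ (1 + log((1+δ)/(1−δ)))^k`
  have hdepth : ∀ δ : ℝ, 0 < δ → δ ≤ 1 / 4 →
      Tendsto (fun x : ℕ => (#((Icc 1 x).filter (fun n : ℕ => ∀ i, 0 < (f i).eval (n : ℤ) ∧
        ∀ p ∈ range ⌈(x : ℝ) ^ (((f i).natDegree : ℝ) * (1 - δ) / 2)⌉₊,
          p.Prime → ¬ ((p : ℤ) ∣ (f i).eval (n : ℤ)))) : ℝ) * Real.log x ^ k / x) atTop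
        (𝓝 (C₀ * (1 + Real.log ((1 + δ) / (1 - δ))) ^ k)) := by
    intro δ hδ0 hδ4
    obtain ⟨u, hu_def⟩ : ∃ u : ℝ, u = 2 / (1 - δ) := ⟨_, rfl⟩
    have h1δ : 0 < 1 - δ := by linarith
    have hu2 : 2 < u := by
      rw [hu_def, lt_div_iff₀ h1δ]; linarith
    have hu3 : u ≤ 3 := by
      rw [hu_def, div_le_iff₀ h1δ]; linarith
    have hexp : ∀ d : ℕ, (d : ℝ) / u = (d : ℝ) * (1 - δ) / 2 := by
      intro d
      rw [hu_def]
      field_simp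
    have hcount : ∀ x : ℕ, #((Icc 1 x).filter (fun n : ℕ => ∀ i, 0 < (f i).eval (n : ℤ) ∧
        ∀ p ∈ range ⌈(x : ℝ) ^ (((f i).natDegree : ℝ) / u)⌉₊,
          p.Prime → ¬ ((p : ℤ) ∣ (f i).eval (n : ℤ)))) =
      #((Icc 1 x).filter (fun n : ℕ => ∀ i, 0 < (f i).eval (n : ℤ) ∧
        ∀ p ∈ range ⌈(x : ℝ) ^ (((f i).natDegree : ℝ) * (1 - δ) / 2)⌉₊,
          p.Prime → ¬ ((p : ℤ) ∣ (f i).eval (n : ℤ)))) := by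
      intro x
      congr 1
      ext n
      simp only [mem_filter, hexp]
    have hval : A * (u * buchstabOmega u) ^ k =
        C₀ * (1 + Real.log ((1 + δ) / (1 - δ))) ^ k := by
      rw [hAeq, buchstabOmega_eq_of_mem_Icc_two_three hu2.le hu3]
      have hu0 : u ≠ 0 := by linarith
      have h1 : u - 1 = (1 + δ) / (1 - δ) := by
        rw [hu_def]
        field_simp
        ring
      rw [mul_div_cancel₀ _ hu0, h1]
    rw [← hval]
    refine (hA u hu2).congr' (Eventually.of_forall fun x => ?_)
    rw [hcount x]
  -- Step 4: choose `δ` with `C₀ (1 + log((1+δ)/(1−δ)))^k < C₀ + ε` (continuity at `δ = 0`)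
  have hφc : ContinuousAt (fun δ : ℝ => C₀ * (1 + Real.log ((1 + δ) / (1 - δ))) ^ k) 0 := by
    fun_prop (disch := norm_num)
  have hevφ : ∀ᶠ δ : ℝ in 𝓝 0, C₀ * (1 + Real.log ((1 + δ) / (1 - δ))) ^ k < C₀ + ε := by
    have := hφc.tendsto
    simp only [add_zero, sub_zero, div_one, Real.log_one, one_pow, mul_one] at this
    exact this.eventually (eventually_lt_nhds (by linarith))
  obtain ⟨r, hr, hrφ⟩ := Metric.eventually_nhds_iff.mp hevφ
  obtain ⟨δ, hδ_def⟩ : ∃ δ : ℝ, δ = min (1 / 4) (r / 2) := ⟨_, rfl⟩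
  have hδ0 : 0 < δ := by rw [hδ_def]; positivity
  have hδ4 : δ ≤ 1 / 4 := by rw [hδ_def]; exact min_le_left _ _
  have hδr : δ < r := by
    rw [hδ_def]; exact lt_of_le_of_lt (min_le_right _ _) (by linarith)
  have hφδ : C₀ * (1 + Real.log ((1 + δ) / (1 - δ))) ^ k < C₀ + ε :=
    hrφ (by rw [Real.dist_eq, sub_zero, abs_of_pos hδ0]; exact hδr)
  -- Step 5: `P_f ≤ Φ_f(x,u) + K + k(2√x+1)` (all degrees) and the remainder is negligible
  have hlim := hdepth δ hδ0 hδ4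
  obtain ⟨K, hK⟩ :=
    Summit.Parity.BatemanHorn.Theorems.BalancedSemiprimeLayer.Negative.polyPrimeCount_le_cruxCount_add
      f hf.leadingCoeff_pos hf.natDegree_pos hδ0.le
  have hrem := Summit.Parity.BatemanHorn.Theorems.RoughValueTransportAssembly.tendsto_remainder K k
  have hsum := hlim.add hrem
  rw [add_zero] at hsum
  filter_upwards [hsum.eventually (eventually_lt_nhds hφδ), eventually_gt_atTop 1] with x hx hx1
  have hx' : (1 : ℝ) < x := by exact_mod_cast hx1
  have hlog : 0 < Real.log x := Real.log_pos hx'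
  have hx0 : (0 : ℝ) < x := by linarith
  have hpow : 0 < Real.log x ^ k := pow_pos hlog k
  -- normalised: `P_f(x)(log x)^k/x < C₀ + ε`
  have hnorm : (polyPrimeCount f x : ℝ) * Real.log x ^ k / x < C₀ + ε := by
    have key : ∀ P Φ R : ℝ, P ≤ Φ + K + R →
        P * Real.log x ^ k / x ≤ Φ * Real.log x ^ k / x + (K + R) * Real.log x ^ k / x := by
      intro P Φ R h
      have h1 : P * Real.log x ^ k / x ≤ (Φ + K + R) * Real.log x ^ k / x :=
        div_le_div_of_nonneg_right (mul_le_mul_of_nonneg_right h hpow.le) hx0.le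
      have h2 : (Φ + K + R) * Real.log x ^ k / x =
          Φ * Real.log x ^ k / x + (K + R) * Real.log x ^ k / x := by ring
      linarith
    exact lt_of_le_of_lt (key _ _ _ (hK x)) hx
  -- un-normalise
  have h1 : (polyPrimeCount f x : ℝ) * Real.log x ^ k / x * (x / Real.log x ^ k) =
      (polyPrimeCount f x : ℝ) := by
    field_simp
  have h2 : (C₀ + ε) * (x / Real.log x ^ k) = (C₀ + ε) * x / Real.log x ^ k := by ring
  have hxq : 0 < (x : ℝ) / Real.log x ^ k := div_pos hx0 hpow
  calc (polyPrimeCount f x : ℝ)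
      = (polyPrimeCount f x : ℝ) * Real.log x ^ k / x * (x / Real.log x ^ k) := h1.symm
    _ ≤ (C₀ + ε) * (x / Real.log x ^ k) := mul_le_mul_of_nonneg_right hnorm.le hxq.le
    _ = (C₀ + ε) * x / Real.log x ^ k := h2

/-- **The rung law for ONE system of ANY degree gives the sharp Bateman–Horn upper bound for that
system**: the body of `RoughValueLaw` at a Bateman–Horn system `f` implies, for every `ε > 0`,
eventually `P_f(x) ≤ (C(f)/∏ deg fᵢ + ε)·x/(log x)^k`; the calibration is the PROVED
`sieveCalibration_proof`. [folklore] -/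
theorem polyPrimeCount_eventually_le_of_systemRoughValueLaw {k : ℕ} {f : Fin k → ℤ[X]}
    (hf : IsBatemanHornSystem f)
    (hR : ∀ ω : ℝ → ℝ, ((∀ u : ℝ, 1 ≤ u → u ≤ 2 → ω u = u⁻¹) ∧ ContinuousOn ω (Set.Ici 1) ∧
        (∀ u : ℝ, 2 < u → HasDerivAt (fun t : ℝ => t * ω t) (ω (u - 1)) u)) →
      ∃ A : ℝ, ∀ u : ℝ, 2 < u → Tendsto (fun x : ℕ =>
        (((Finset.Icc 1 x).filter (fun n : ℕ => ∀ i, 0 < (f i).eval (n : ℤ) ∧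
          ∀ p ∈ Finset.range ⌈(x : ℝ) ^ (((f i).natDegree : ℝ) / u)⌉₊,
            p.Prime → ¬ ((p : ℤ) ∣ (f i).eval (n : ℤ)))).card : ℝ) * Real.log x ^ k / (x : ℝ))
        atTop (𝓝 (A * (u * ω u) ^ k))) :
    ∀ ε : ℝ, 0 < ε → ∀ᶠ x : ℕ in atTop, (polyPrimeCount f x : ℝ) ≤
      (batemanHornConst f / (∏ i, ((f i).natDegree : ℝ)) + ε) * x / Real.log x ^ k :=
  polyPrimeCount_eventually_le_of_parts hf hR (sieveCalibration_proof k f hf)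

/-- **STRENGTH CERTIFICATE, all degrees (registered form).**  `RoughValueLaw` implies the SHARP
Bateman–Horn upper bound `P_f(x) ≤ (C(f)/∏ deg fᵢ + ε)·x/(log x)^k` (every `ε > 0`, all large `x`)
for EVERY Bateman–Horn system of every degree — factor `1` in front of the conjectured constant,
against the parity-limited factor `≥ 2` of every upper-bound sieve. [folklore] -/
theorem stub_sharpUpperBound :
    Summit.Parity.BatemanHorn.Theses.RoughValueTransport.RoughValueLaw →
      ∀ (k : ℕ) (f : Fin k → ℤ[X]), IsBatemanHornSystem f → ∀ ε : ℝ, 0 < ε →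
        ∀ᶠ x : ℕ in atTop, (polyPrimeCount f x : ℝ) ≤
          (batemanHornConst f / (∏ i, ((f i).natDegree : ℝ)) + ε) * x / Real.log x ^ k :=
  fun hR k f hf => polyPrimeCount_eventually_le_of_systemRoughValueLaw hf (hR k f hf)

/-- **`RoughValueLaw` ⇒ the sharp Bateman–Horn upper bound for every system of every degree**
(curried form of `stub_sharpUpperBound`). [folklore] -/
theorem sharpUpperBound_of_roughValueLaw (hR : RoughValueLaw) {k : ℕ} {f : Fin k → ℤ[X]}
    (hf : IsBatemanHornSystem f) {ε : ℝ} (hε : 0 < ε) :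
    ∀ᶠ x : ℕ in atTop, (polyPrimeCount f x : ℝ) ≤
      (batemanHornConst f / (∏ i, ((f i).natDegree : ℝ)) + ε) * x / Real.log x ^ k :=
  stub_sharpUpperBound hR k f hf ε hε

end Summit.Parity.BatemanHorn.Cruxes.RoughValueLaw.Strength

end
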